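import Summits.CriticalPhenomena.CardyFormulaZ2.Theorems.CardySelfDualSegmentUniformMarginalityDefs
import Summits.CriticalPhenomena.CardyFormulaZ2.Theorems.UniformMarginality.Negative.BasePointLimit

/-!
# Crux `UniformMarginality` (stmt-CriticalPhenomena-5472), line `Sketch` (skeleton v6):
# sub-goal `fixedDomainContinuity_zero` — fixed-parameter domain continuity at the Smirnov point

The `t₀ = 0` instance of the stub (B₂a″) `stub_fixedDomainContinuity` of the lead's skeleton
(`Cruxes/UniformMarginality/Lines/Sketch.lean`, namespace
`Summit.CriticalPhenomena.CardyFormulaZ2.Cruxes.UniformMarginality.HeatFlow`): for every conformal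
rectangle `R` and `ε > 0` there is a closeness `ε₀ > 0` such that every (rectilinear) conformal
rectangle `Q` whose boundary loop and marks are `ε₀`-close to those of `R` has a mesh threshold
`δ₀(Q) > 0` with `|P_0(Q, δ) − P_0(R, δ)| ≤ ε` for `0 < δ < δ₀` (`Pext · δ 0 = cornerCrossingProb 0 · δ`,
the crude crossing probability of the corner model `M_0` = site percolation on the triangular
lattice in the corner rendering).

Proof (a composition of landed results, no percolation estimate beyond Smirnov's theorem):
* at `t = 0` the crude crossing probabilities of EVERY conformal rectangle `R` converge as
  `δ → 0⁺` to Cardy's value `F(η(φ_ζ R))` of the SHEARED rectangle `φ_ζ R = R.map (shearHomeomorph ζ)`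
  (`ShearedSandwich.hasCrossingLimit_shear`, the proof of the route support `SmirnovBasePoint`,
  read in any uniformizing datum of `φ_ζ R`, `MarkedDomain.exists_isUniformizing_holds`);
* the shear `φ_ζ` is `√(3/2)`-Lipschitz (`ShearDictionary.dist_moduliShear_triZeta_le`) and
  `MarkedDomain.map` transports the boundary loop pointwise and keeps the marks, so `φ_ζ Q` is
  `ε₁`-close to `φ_ζ R` as soon as `Q` is `ε₁/2`-close to `R`;
* the Cardy value is continuous in the marked Jordan domain (Radó / Carathéodory:
  `OracleSandwich.stub_cardyContinuity`, a landed theorem), giving `|F(η(φ_ζ Q)) − F(η(φ_ζ R))| ≤ ε/3`;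
* triangle inequality below the smaller of the two mesh thresholds at accuracy `ε/3`.
The rectilinearity hypothesis on `Q` is not used.
-/

noncomputable section

namespace Summit.CriticalPhenomena.CardyFormulaZ2.Cruxes.UniformMarginality.HeatFlow

open Filter Topology
open Literature.Probability.Percolation Literature.Probability.LatticeModels
  Literature.Probability.RandomPlanarGeometry
open Literature.Barriers.CriticalPhenomena (shearHomeomorph moduliShear)
open Summit.CriticalPhenomena.CardyFormulaZ2.Cruxes.SmirnovBasePoint.ShearedSandwich
  (hasCrossingLimit_shear tendsto_sqrt_two_mul sqrt_two_mul_div_sqrt_two')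
open Summit.CriticalPhenomena.CardyFormulaZ2.Cruxes.SmirnovBasePoint.ShearedSandwich.ShearDictionary
  (dist_moduliShear_triZeta_le)
open Summit.CriticalPhenomena.CardyFormulaZ2.Cruxes.LoopsToCrossings.OracleSandwich
  (stub_cardyContinuity)

/-- **Smirnov's theorem in the corner rendering, identified limit**: at `t = 0` the crude crossing
probabilities of `R` converge, as `δ → 0⁺`, to Cardy's value `F(crossRatio x)` for every
uniformizing datum `(φ, x)` of the sheared rectangle `φ_ζ R` (the proof of
`Negative.cornerCrossingProb_zero_tendsto`, with the limit named). -/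
theorem tendsto_cornerCrossingProb_zero_of_isUniformizing_shear (R : ConformalRectangle)
    (φ : ConformalEquiv UpperHalfPlane.upperHalfPlaneSet
      (R.map (shearHomeomorph triZeta triZeta_im_ne_zero)).carrier)
    (x : Fin 4 → ℝ)
    (hφ : (R.map (shearHomeomorph triZeta triZeta_im_ne_zero)).IsUniformizing φ x) :
    Tendsto (cornerCrossingProb 0 R) (𝓝[>] 0)
      (𝓝 (Literature.Probability.RandomPlanarGeometry.cardyFunction (crossRatio x))) := by
  have h := (hasCrossingLimit_shear R φ x hφ).comp tendsto_sqrt_two_mul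
  refine h.congr fun δ => ?_
  simp only [Function.comp_apply, sqrt_two_mul_div_sqrt_two']

/-- `ε`–`δ₀` form of a one-sided limit at `0⁺`: if `f δ → L` as `δ → 0⁺` then for every `e > 0`
there is `δ₀ > 0` with `|f δ − L| < e` for `0 < δ < δ₀`. -/
theorem exists_threshold_of_tendsto_nhdsGT {f : ℝ → ℝ} {L : ℝ}
    (h : Tendsto f (𝓝[>] 0) (𝓝 L)) {e : ℝ} (he : 0 < e) :
    ∃ δ₀ > 0, ∀ δ : ℝ, 0 < δ → δ < δ₀ → |f δ - L| < e := by
  have hev : ∀ᶠ δ in 𝓝[>] (0 : ℝ), dist (f δ) L < e := Metric.tendsto_nhds.1 h e he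
  rw [eventually_nhdsWithin_iff, Metric.eventually_nhds_iff] at hev
  obtain ⟨δ₀, hδ₀, hball⟩ := hev
  refine ⟨δ₀, hδ₀, fun δ hδ hδδ₀ => ?_⟩
  have h' : dist (f δ) L < e :=
    hball (by rw [Real.dist_eq, sub_zero, abs_of_pos hδ]; exact hδδ₀) hδ
  rwa [Real.dist_eq] at h'

/-- `√(3/2) ≤ 2` (the Lipschitz constant of the shear `φ_ζ` is at most `2`). -/
theorem sqrt_three_halves_le_two : Real.sqrt (3 / 2) ≤ 2 := by
  have h1 : Real.sqrt (3 / 2) ^ 2 = 3 / 2 := Real.sq_sqrt (by norm_num)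
  nlinarith [Real.sqrt_nonneg (3 / 2 : ℝ)]

/-- The sheared rectangles `φ_ζ Q`, `φ_ζ R` are `ε₁`-close in boundary loop as soon as `Q`, `R` are
`ε₁ / 2`-close (`MarkedDomain.map` transports the loop pointwise; `φ_ζ` is `√(3/2)`-Lipschitz). -/
theorem dist_boundary_map_shear_le {Q R : ConformalRectangle} {ε₁ : ℝ}
    (hQb : ∀ u : ℝ, dist (Q.boundary u) (R.boundary u) ≤ ε₁ / 2) (u : ℝ) :
    dist ((Q.map (shearHomeomorph triZeta triZeta_im_ne_zero)).boundary u)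
        ((R.map (shearHomeomorph triZeta triZeta_im_ne_zero)).boundary u) ≤ ε₁ :=
  calc dist ((Q.map (shearHomeomorph triZeta triZeta_im_ne_zero)).boundary u)
        ((R.map (shearHomeomorph triZeta triZeta_im_ne_zero)).boundary u)
      = dist (moduliShear triZeta (Q.boundary u)) (moduliShear triZeta (R.boundary u)) := rfl
    _ ≤ Real.sqrt (3 / 2) * dist (Q.boundary u) (R.boundary u) := dist_moduliShear_triZeta_le _ _
    _ ≤ 2 * (ε₁ / 2) := mul_le_mul sqrt_three_halves_le_two (hQb u) dist_nonneg zero_le_two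
    _ = ε₁ := by ring

/-- `Pext R δ 0` is the crude `M_0` crossing probability `cornerCrossingProb 0 R δ`. -/
theorem Pext_zero (R : ConformalRectangle) (δ : ℝ) : Pext R δ 0 = cornerCrossingProb 0 R δ := by
  rw [← Pext_coe R δ 0]
  rfl

/-- **Sub-goal `fixedDomainContinuity_zero`** (the `t₀ = 0` instance of (B₂a″)
`stub_fixedDomainContinuity`, skeleton v6 of line `Sketch`): for every conformal rectangle `R` and
`ε > 0` there is `ε₀ > 0` such that every rectilinear conformal rectangle `Q` whose boundary loop
and marks are `ε₀`-close to those of `R` has a mesh threshold `δ₀ > 0` with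
`|Pext Q δ 0 − Pext R δ 0| ≤ ε` for all `0 < δ < δ₀`. Smirnov's theorem for the sheared domains
(`hasCrossingLimit_shear`) + continuity of the Cardy value in the marked domain
(`stub_cardyContinuity`); the rectilinearity of `Q` is not used. -/
theorem fixedDomainContinuity_zero :
    ∀ (R : ConformalRectangle) (ε : ℝ), 0 < ε → ∃ ε₀ > 0, ∀ Q : ConformalRectangle,
      (∃ S : Finset (ℂ × ℂ), (∀ p ∈ S, p.1.re = p.2.re ∨ p.1.im = p.2.im) ∧
        frontier Q.carrier ⊆ ⋃ p ∈ S, segment ℝ p.1 p.2) →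
      (∀ u : ℝ, dist (Q.boundary u) (R.boundary u) ≤ ε₀) → (∀ i : Fin 4, |Q.mark i - R.mark i| ≤ ε₀) →
      ∃ δ₀ > 0, ∀ δ : ℝ, 0 < δ → δ < δ₀ → |Pext Q δ 0 - Pext R δ 0| ≤ ε := by
  intro R ε hε
  -- the sheared rectangle `φ_ζ R`, a uniformizing datum and its Cardy value `L_R = F(crossRatio x)`
  obtain ⟨φ, x, hφ⟩ :=
    MarkedDomain.exists_isUniformizing_holds (R.map (shearHomeomorph triZeta triZeta_im_ne_zero))
  -- continuity of the Cardy value at `φ_ζ R`, accuracy `ε / 3`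
  obtain ⟨ε₁, hε₁, hcont⟩ :=
    stub_cardyContinuity (R.map (shearHomeomorph triZeta triZeta_im_ne_zero)) φ x hφ (ε / 3)
      (by positivity)
  refine ⟨ε₁ / 2, by positivity, fun Q _hQ hQb hQm => ?_⟩
  -- a uniformizing datum of `φ_ζ Q`
  obtain ⟨ψ, y, hψ⟩ :=
    MarkedDomain.exists_isUniformizing_holds (Q.map (shearHomeomorph triZeta triZeta_im_ne_zero))
  -- `φ_ζ Q` is `ε₁`-close to `φ_ζ R` in loop and marks, so the Cardy values are `ε/3`-close
  have hm : ∀ i : Fin 4,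
      |(Q.map (shearHomeomorph triZeta triZeta_im_ne_zero)).mark i -
        (R.map (shearHomeomorph triZeta triZeta_im_ne_zero)).mark i| ≤ ε₁ := fun i =>
    (hQm i).trans (by linarith)
  have hF : |Literature.Probability.RandomPlanarGeometry.cardyFunction (crossRatio y) -
      Literature.Probability.RandomPlanarGeometry.cardyFunction (crossRatio x)| ≤ ε / 3 :=
    hcont _ (dist_boundary_map_shear_le hQb) hm ψ y hψ
  -- mesh thresholds for `Q` and for `R` at accuracy `ε / 3`
  obtain ⟨δQ, hδQ, hQlim⟩ := exists_threshold_of_tendsto_nhdsGT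
    (tendsto_cornerCrossingProb_zero_of_isUniformizing_shear Q ψ y hψ) (e := ε / 3) (by positivity)
  obtain ⟨δR, hδR, hRlim⟩ := exists_threshold_of_tendsto_nhdsGT
    (tendsto_cornerCrossingProb_zero_of_isUniformizing_shear R φ x hφ) (e := ε / 3) (by positivity)
  refine ⟨min δQ δR, lt_min hδQ hδR, fun δ hδ hδδ₀ => ?_⟩
  have h1 := hQlim δ hδ (lt_of_lt_of_le hδδ₀ (min_le_left _ _))
  have h2 := hRlim δ hδ (lt_of_lt_of_le hδδ₀ (min_le_right _ _))
  rw [Pext_zero, Pext_zero]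
  rw [abs_lt] at h1 h2
  rw [abs_le] at hF ⊢
  constructor <;> linarith [hF.1, hF.2, h1.1, h1.2, h2.1, h2.2]

end Summit.CriticalPhenomena.CardyFormulaZ2.Cruxes.UniformMarginality.HeatFlow

end
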